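import Mathlib.Analysis.Complex.Basic
import Mathlib.Order.ConditionallyCompleteLattice.Basic
import Literature.Computability.AlgebraicComplexity.MatrixMultiplicationExponent
import HarnessLib

/-!
# Frobenius `η`-rank of a 3-tensor and the approximation profile

Topic `Literature/Computability/AlgebraicComplexity`; definition item `defn-approxRank` for route
`MatrixMultiplication/ApproximationProfile` (whose items `Rigidity`, `Softness`, `MetricStrassen`,
`LowerFrame`, `Flatness`, … inline the notion with `t = ⟨n,n,n⟩`, `Σ‖t‖² = n³`).

For a coordinate 3-tensor `t ∈ ℂ^{ι×κ×μ}` (finite index types) and `η ∈ ℝ`: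

* `frobApproxRank η t` — the **Frobenius `η`-rank** (the requested name `approxRank` is taken
  by Schönhage's degree-`h` approximate rank `R_h` in `SchoenhageTau.lean`, a different notion):
  the least `r` such that some tensor `S` of rank `≤ r` (`tensorRank`, the tree's `R(·)` over `ℂ`)
  is within RELATIVE squared Frobenius distance `η`:
  `Σ_{abc} ‖t_{abc} − S_{abc}‖² ≤ η · Σ_{abc} ‖t_{abc}‖²` (an `sInf` over `ℕ`; the set is
  non-empty for `η ≥ 0` — `S = t` — and upward closed, so the infimum is attained,
  `frobApproxRank_le_iff`; for `η < 0` and `t ≠ 0` it is empty and the value is the junk `0`);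
* `frobApproxError t r` — the **approximation profile** `E(t, r) = inf_{R(S) ≤ r} Σ‖t − S‖² / Σ‖t‖²`
  (`0` by Lean's `x / 0 = 0` when `t = 0`).

This is the best rank-`r` approximation problem of de Silva–Lim 2008 (§1, problem (†):
`argmin_{rank(B) ≤ r} ‖A − B‖`; §5: the infimum `inf{‖C − A‖ : rank A ≤ r}`, which for `k = 3`
need not be attained — the notions here are infima and never assert a minimiser), read with the
relative squared Frobenius error that the route fixes; for matrices it is governed by the
Eckart–Young–Mirsky theorem (Mirsky 1960).

## API (all proved)

`frobApproxRank_le_iff` (`η ≥ 0`: `frobApproxRank η t ≤ r ↔ ∃ S, R(S) ≤ r ∧ error ≤ η Σ‖t‖²`),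
`frobApproxRank_le_tensorRank` (`η ≥ 0`), `frobApproxRank_anti` (antitone in `η` on `[0, ∞)`),
`frobApproxRank_eq_zero_of_one_le` (`η ≥ 1`: `S = 0`), `frobApproxRank_zero` (`η = 0`: equals
`R(t)`), `frobApproxError_nonneg`, `frobApproxError_le_one`.

Not here (route items): the Eckart–Young floor `frobApproxRank η ⟨n,n,n⟩ ≥ (1−η)n²` (`LowerFrame`),
unitary invariance, and the bridge `E(t, r) = 0 ↔ border rank ≤ r` (`algBorderRank`).

## References

* V. de Silva, L.-H. Lim, *Tensor rank and the ill-posedness of the best low-rank approximation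
  problem*, SIAM J. Matrix Anal. Appl. 30 (2008) 1084–1127, §1 (†), §5. [DesilvaLim2008]
* L. Mirsky, *Symmetric gauge functions and unitarily invariant norms*, Quart. J. Math. 11 (1960)
  50–59. [Mirsky1960]
* M. Bläser, *Fast Matrix Multiplication*, Theory of Computing Graduate Surveys 5 (2013), §4
  (tensor rank). [Blaser2013]
-/

noncomputable section

open scoped BigOperators

namespace Literature.Computability.AlgebraicComplexity

variable {ι κ μ : Type*} [Fintype ι] [Fintype κ] [Fintype μ]

/-- The **Frobenius `η`-rank** of `t ∈ ℂ^{ι×κ×μ}`: the least `r` such that some `S` with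
`tensorRank S ≤ r` has `Σ ‖t_{abc} − S_{abc}‖² ≤ η · Σ ‖t_{abc}‖²` (relative squared Frobenius
error at most `η`). An `sInf` over `ℕ` (junk value `0` only if the set is empty, i.e. `η < 0`
and `t ≠ 0`). The best rank-`r` approximation problem of de Silva–Lim, in the relative
mean-square form used by route `ApproximationProfile`.
[cite: DesilvaLim2008, §1 problem (†) and §5 (inf{‖C − A‖ : rank A ≤ r})] -/
def frobApproxRank (η : ℝ) (t : ι → κ → μ → ℂ) : ℕ :=
  sInf {r : ℕ | ∃ S : ι → κ → μ → ℂ, tensorRank S ≤ r ∧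
    ∑ a, ∑ b, ∑ c, ‖t a b c - S a b c‖ ^ 2 ≤ η * ∑ a, ∑ b, ∑ c, ‖t a b c‖ ^ 2}

/-- The **approximation profile** `E(t, r) = inf {Σ‖t − S‖² : tensorRank S ≤ r} / Σ‖t‖²`, the
best relative squared Frobenius error achievable at rank `≤ r` (an infimum, in general not
attained for 3-tensors — de Silva–Lim; value `0` for `t = 0` by `x / 0 = 0`).
[cite: DesilvaLim2008, §1 problem (†) and §5] -/
def frobApproxError (t : ι → κ → μ → ℂ) (r : ℕ) : ℝ :=
  sInf {e : ℝ | ∃ S : ι → κ → μ → ℂ, tensorRank S ≤ r ∧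
      e = ∑ a, ∑ b, ∑ c, ‖t a b c - S a b c‖ ^ 2} / ∑ a, ∑ b, ∑ c, ‖t a b c‖ ^ 2

variable (η : ℝ) (t : ι → κ → μ → ℂ)

/-- The defining set of `frobApproxRank`. [folklore] -/
theorem frobApproxRank_def : frobApproxRank η t =
    sInf {r : ℕ | ∃ S : ι → κ → μ → ℂ, tensorRank S ≤ r ∧
      ∑ a, ∑ b, ∑ c, ‖t a b c - S a b c‖ ^ 2 ≤ η * ∑ a, ∑ b, ∑ c, ‖t a b c‖ ^ 2} :=
  rfl

variable {η t}

/-- The squared Frobenius norm is non-negative. [folklore] -/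
theorem frobeniusSq_nonneg (t : ι → κ → μ → ℂ) : 0 ≤ ∑ a, ∑ b, ∑ c, ‖t a b c‖ ^ 2 :=
  Finset.sum_nonneg fun _ _ => Finset.sum_nonneg fun _ _ => Finset.sum_nonneg fun _ _ =>
    by positivity

/-- For `η ≥ 0` the tensor itself is an admissible approximant: `tensorRank t` lies in the
defining set. [folklore] -/
theorem tensorRank_mem_frobApproxSet (hη : 0 ≤ η) :
    tensorRank t ∈ {r : ℕ | ∃ S : ι → κ → μ → ℂ, tensorRank S ≤ r ∧
      ∑ a, ∑ b, ∑ c, ‖t a b c - S a b c‖ ^ 2 ≤ η * ∑ a, ∑ b, ∑ c, ‖t a b c‖ ^ 2} :=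
  ⟨t, le_rfl, by simpa using mul_nonneg hη (frobeniusSq_nonneg t)⟩

/-- **Characterisation** (for `η ≥ 0`): `frobApproxRank η t ≤ r` iff some `S` of rank `≤ r` is
within relative squared error `η` (the defining set is non-empty and upward closed). [folklore] -/
theorem frobApproxRank_le_iff (hη : 0 ≤ η) (r : ℕ) :
    frobApproxRank η t ≤ r ↔ ∃ S : ι → κ → μ → ℂ, tensorRank S ≤ r ∧
      ∑ a, ∑ b, ∑ c, ‖t a b c - S a b c‖ ^ 2 ≤ η * ∑ a, ∑ b, ∑ c, ‖t a b c‖ ^ 2 := by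
  constructor
  · intro h
    obtain ⟨S, hS, herr⟩ := Nat.sInf_mem ⟨_, tensorRank_mem_frobApproxSet (t := t) hη⟩
    exact ⟨S, hS.trans h, herr⟩
  · rintro ⟨S, hS, herr⟩
    exact Nat.sInf_le ⟨S, hS, herr⟩

/-- `frobApproxRank η t ≤ tensorRank t` for `η ≥ 0` (take `S = t`). [folklore] -/
theorem frobApproxRank_le_tensorRank (hη : 0 ≤ η) : frobApproxRank η t ≤ tensorRank t :=
  Nat.sInf_le (tensorRank_mem_frobApproxSet (t := t) hη)

/-- **Antitone in the error level** on `[0, ∞)`: a larger tolerated error needs no more rank.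
[folklore] -/
theorem frobApproxRank_anti {η η' : ℝ} (hη : 0 ≤ η) (h : η ≤ η') :
    frobApproxRank η' t ≤ frobApproxRank η t := by
  obtain ⟨S, hS, herr⟩ := (frobApproxRank_le_iff (t := t) hη _).1 le_rfl
  exact (frobApproxRank_le_iff (t := t) (hη.trans h) _).2
    ⟨S, hS, herr.trans (mul_le_mul_of_nonneg_right h (frobeniusSq_nonneg t))⟩

/-- At relative error `≥ 1` the zero tensor qualifies: `frobApproxRank η t = 0` for `η ≥ 1`.
[folklore] -/
theorem frobApproxRank_eq_zero_of_one_le (h : 1 ≤ η) : frobApproxRank η t = 0 := by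
  refine Nat.le_zero.1 ((frobApproxRank_le_iff (zero_le_one.trans h) 0).2 ⟨0, ?_, ?_⟩)
  · rw [tensorRank_zero]
  · simpa using le_mul_of_one_le_left (frobeniusSq_nonneg t) h

/-- At error `0` only `S = t` qualifies: `frobApproxRank 0 t = tensorRank t`. [folklore] -/
theorem frobApproxRank_zero : frobApproxRank 0 t = tensorRank t := by
  refine le_antisymm (frobApproxRank_le_tensorRank le_rfl) ?_
  obtain ⟨S, hS, herr⟩ := (frobApproxRank_le_iff (η := (0 : ℝ)) (t := t) le_rfl _).1 le_rfl
  rw [zero_mul] at herr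
  have hzero : ∀ a b c, ‖t a b c - S a b c‖ ^ 2 = 0 := by
    have h1 := (Finset.sum_eq_zero_iff_of_nonneg fun a _ =>
      Finset.sum_nonneg fun b _ => Finset.sum_nonneg fun c _ => by positivity).1
      (le_antisymm herr (frobeniusSq_nonneg _))
    intro a b c
    have h2 := (Finset.sum_eq_zero_iff_of_nonneg fun b _ =>
      Finset.sum_nonneg fun c _ => by positivity).1 (h1 a (Finset.mem_univ a)) b (Finset.mem_univ b)
    exact (Finset.sum_eq_zero_iff_of_nonneg fun c _ => by positivity).1 h2 c (Finset.mem_univ c)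
  have hSt : S = t := by
    funext a b c
    have := hzero a b c
    rw [sq_eq_zero_iff, norm_eq_zero, sub_eq_zero] at this
    exact this.symm
  rwa [hSt] at hS

/-- The profile is non-negative. [folklore] -/
theorem frobApproxError_nonneg (t : ι → κ → μ → ℂ) (r : ℕ) : 0 ≤ frobApproxError t r := by
  refine div_nonneg (Real.sInf_nonneg ?_) (frobeniusSq_nonneg t)
  rintro e ⟨S, -, rfl⟩
  exact frobeniusSq_nonneg _

/-- The profile is at most `1` (the zero tensor is an approximant of every rank). [folklore] -/
theorem frobApproxError_le_one (t : ι → κ → μ → ℂ) (r : ℕ) : frobApproxError t r ≤ 1 := by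
  unfold frobApproxError
  rcases (frobeniusSq_nonneg t).eq_or_lt with h0 | hpos
  · rw [← h0, div_zero]; exact zero_le_one
  · rw [div_le_one hpos]
    refine csInf_le ⟨0, ?_⟩ ⟨0, by rw [tensorRank_zero]; exact Nat.zero_le r, by simp⟩
    rintro e ⟨S, -, rfl⟩
    exact frobeniusSq_nonneg _

end Literature.Computability.AlgebraicComplexity
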